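import Summits.BirchSwinnertonDyer.BirchSwinnertonDyer.Theorems.Rank1ResidualJetCarrierNeKit
import HarnessLib

/-!
# T1 JET (cell `bsd-jet`), bucket A (`q ≠ p`): SAMPLE by-name record through the flag-free kit —
# `285a1` at `p = 5` (carrier `q = 3`, `c₃ = 5`), both image roads

HONEST FRAMING (programme file §HONESTY, verbatim): «no tranche here proves BSD; ARM L moves the
LITERAL column of an r ≤ 1 census into the kernel-proved-modulo-named-print column». THEOREMS ONLY
(seat `bsd-jet-pv-1`; `--supports stmt-BirchSwinnertonDyer-14418`, helper). PURPOSE: a worked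
TEMPLATE for the row generator (seat `bsd-jet-ty`) showing that the record kit
`Rank1ResidualJetCarrierNeKit.lean` elaborates on Cremona data with every numeric step a `decide`
goal — ONE register cell, `(285a1, 5)` of bucket A (census `HOME/jet_rows.tsv` 29cec7d45121a57c:
`N = 285 = 3·5·19`, `r = 1`, reduction at `5` non-split `I₁` (`c₅ = 1`), stringent prime `q = 3`
split `I₅` (`c₃ = 5`, `ord₅ c₃ = 1 = m_max`), `19` split `I₂`; galrep at `5` surjective; lane datum
`D = −56`, `ord₅ I_K = 1`), Cremona model `[1, 0, 0, 19, 0]` (`Δ = −438615 = −3⁵·5·19²`,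
`c₄ = −911`). Two roads to the image input: (a) `bsdp_jetA_285a1_5_ram` — multiplicative at `5`
(`5 ∣ Δ`, `5 ∤ c₄`), `E[5]` irreducible by the Frobenius witness `ℓ = 11` (`#Ẽ(𝔽₁₁) = 18`,
`a₁₁ = −6`, `X² + X + 1` has no root mod `5`), (ram) witness `19` (`19² ∥ Δ`, `5 ∤ 2`), tower by the
Tate line; (b) `bsdp_jetA_285a1_5_serre` — Serre Prop. 19 witnesses `(7, 10)` (`a = −2`,
`a² − 28 ≡ 1` a non-zero square mod `5`), `(11, 18)` (`a = −6`, `a² − 44 ≡ 2` a non-square),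
`(17, 24)` (`a = −6`, `u = 36/17 ≡ 3`, `u² − 3u + 1 ≡ 1`). DISPLAYED BINDERS (not re-checked in the
kernel, exactly as in every Heegner-index record of the cell): the READING binder `hJ`
(`JET.JetchevDivisibilityCarrierNe`, audit sheet `HOME/sheets/PV1-A-BLOCK-READING.md`, referee's word
pending), the published `hMcU`, `hGZK`, `hKo`, `hrec`, `hD36`, `hlev`; the Heegner datum (`K` with
`d_K ∉ {−3, −4}` — e.g. the lane's `ℚ(√−56)` —, level `N` with `3 ∣ N`, Heegner point `P` of infinite
order), the two-engine index line `ord₅ [E(K):ℤP] ≤ ord₅ c₃(E)`, `r_an ≤ 1`, `#Ш_an` a `5`-adic unit.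
Nothing is booked by this file (bookings are referee A's, on the reading and on a two-engine index
line); it is a template, not an offer. PARTITION: row D5 `JET@p∣N` bucket A — 0 classes moved.

References: [Jetchev2008] Cor. 1.5 (p. 812); [Cremona2006] Table 1 (label 285a1); [Serre1972] §2.8
Prop. 19, §2.4 Prop. 15; [Mazur1978] Prop. 6.3 (1); [Miller2011LMS] Def. 1.1.
-/

set_option autoImplicit false

noncomputable section

open scoped Classical

open WeierstrassCurve Literature.NumberTheory.EllipticCurves
  Literature.NumberTheory.EllipticCurves.ModularForms
  Literature.NumberTheory.EllipticCurves.Rank1Residual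
  Literature.NumberTheory.EllipticCurves.Rank1Residual.X11RankOneCertificates
  Summit.BirchSwinnertonDyer.BirchSwinnertonDyer.Rank1Residual
  Summit.BirchSwinnertonDyer.BirchSwinnertonDyer.Rank1Residual.IntModel
  Summit.BirchSwinnertonDyer.BirchSwinnertonDyer.Rank1Residual.X11RankOne
  Summit.BirchSwinnertonDyer.Rank1Residual Summit.BirchSwinnertonDyer.Rank1Residual.X11b

namespace Summit.BirchSwinnertonDyer.Rank1Residual.JET

/-- **`BSD(E,5)` for `285a1` through the bucket-A kit, (ram) road** (`N = 285 = 3·5·19`; model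
`[1,0,0,19,0]`, `Δ = −3⁵·5·19²`, `c₄ = −911`; multiplicative (non-split `I₁`) at `5`; carrier `q = 3`,
`c₃ = 5`; `r_an = 1`; `#Ш_an = 1`). Kernel: `Δ ≠ 0`, support `[(3,1,5),(5,1,1),(19,1,2)]` with the
Silverman disjunct at each prime, `5 ∣ Δ`, `5 ∤ c₄`, Frobenius witness `(11, 18)` for `Irr`, (ram)
witness `19` with `19² ∥ Δ`. Displayed binders: `hJ` (READING), `hMcU`, `hGZK`, `hKo`, `hrec`, `hD36`,
`hlev` (published), the Heegner datum and the index line at `q = 3`. CONDITIONAL; nothing booked.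
[cite: Jetchev2008, Cor. 1.5 (p. 812)] [cite: Cremona2006, Table 1 (label 285a1)]
[cite: Mazur1978, §6 Prop. 6.3 (1) (p. 153)] [cite: Serre1972, §2.4 Prop. 15] -/
theorem bsdp_jetA_285a1_5_ram
    (hJ : JetchevDivisibilityCarrierNe)
    (hMcU : McCallum1991_padicValNat_card_sha_primary_add_le_of_globalDivisibility)
    (hGZK : rank_eq_analyticRank_of_analyticRank_le_one)
    (hKo : ∀ (N : ℕ) [NeZero N] (W : WeierstrassCurve ℚ) (K : Type) [Field K] [NumberField K],
      kolyvagin N W K)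
    (hrec : ∀ (N : ℕ) [NeZero N] (W : WeierstrassCurve ℚ) (K : Type) [Field K] [NumberField K],
      heegnerPointOfConductor_one_galoisConj N W K)
    (hD36 : ∀ (N : ℕ) [NeZero N] (W : WeierstrassCurve ℚ) (K : Type) [Field K] [NumberField K],
      phi_heegnerTau_mem_singularModuliField N W K)
    (hlev : ∀ {N : ℕ} [NeZero N], IsNewformOf.level_eq_conductorNorm (N := N))
    (W : WeierstrassCurve ℚ) (hW : W = ⟨1, 0, 0, 19, 0⟩)
    {N : ℕ} [NeZero N] {K : Type} [Field K] [NumberField K] (hK : IsImaginaryQuadratic K)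
    (hD3 : NumberField.discr K ≠ -3) (hD4 : NumberField.discr K ≠ -4)
    (hH : SatisfiesHeegnerHypothesis N K) {P : (W.baseChange K).toAffine.Point}
    (hP : IsHeegnerPoint N W K P) (hnt : ¬ IsOfFinAddOrder P) (hqN : 3 ∣ N)
    (hI : padicValNat 5 (AddSubgroup.zmultiples P).index ≤
      padicValNat 5 ((W.baseChange ℚ_[3]).localTamagawaNumber ℤ_[3]))
    (hr : W.analyticRank ≤ 1) {s : ℚ} (hs : shaAn W = (s : ℂ)) (hv : padicValRat 5 s = 0) :
    BSDp W 5 :=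
  bsdp_of_jetRowCarrierNe_of_mult_of_ram 5 (by norm_num) (by norm_num) 1 0 0 19 0 (by decide +kernel)
    [(3, 1, 5), (5, 1, 1), (19, 1, 2)]
    (by intro t ht; simp only [List.mem_cons, List.not_mem_nil, or_false] at ht
        rcases ht with rfl | rfl | rfl <;> norm_num)
    (by decide +kernel) (by decide +kernel)
    (by decide +kernel) (by decide +kernel) 11 (by norm_num) (by norm_num) (by norm_num)
    (by decide +kernel) (n := 18) (by decide +kernel) (by decide +kernel) 19 (by norm_num) (by norm_num)
    (by decide +kernel) (by decide +kernel) (e := 2) (by decide +kernel) (by decide +kernel)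
    (by norm_num) hJ hMcU hGZK hKo hrec hD36 hlev W hW hK hD3 hD4 hH hP hnt 3 Nat.prime_three hqN
    (by norm_num) hI hr hs hv

/-- **`BSD(E,5)` for `285a1` through the bucket-A kit, Serre-witness road** (same pair; image by
Serre's Prop. 19 from the witnesses `(7, 10)` split, `(11, 18)` non-split, `(17, 24)` with `u ≡ 3`;
tower by Serre IV-23 since `p = 5 ≥ 5`). Displayed binders as in `bsdp_jetA_285a1_5_ram`.
CONDITIONAL; nothing booked. [cite: Jetchev2008, Cor. 1.5 (p. 812)]
[cite: Cremona2006, Table 1 (label 285a1)] [cite: Serre1972, §2.8 Prop. 19] -/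
theorem bsdp_jetA_285a1_5_serre
    (hJ : JetchevDivisibilityCarrierNe)
    (hMcU : McCallum1991_padicValNat_card_sha_primary_add_le_of_globalDivisibility)
    (hGZK : rank_eq_analyticRank_of_analyticRank_le_one)
    (hKo : ∀ (N : ℕ) [NeZero N] (W : WeierstrassCurve ℚ) (K : Type) [Field K] [NumberField K],
      kolyvagin N W K)
    (hrec : ∀ (N : ℕ) [NeZero N] (W : WeierstrassCurve ℚ) (K : Type) [Field K] [NumberField K],
      heegnerPointOfConductor_one_galoisConj N W K)
    (hD36 : ∀ (N : ℕ) [NeZero N] (W : WeierstrassCurve ℚ) (K : Type) [Field K] [NumberField K],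
      phi_heegnerTau_mem_singularModuliField N W K)
    (hlev : ∀ {N : ℕ} [NeZero N], IsNewformOf.level_eq_conductorNorm (N := N))
    (W : WeierstrassCurve ℚ) (hW : W = ⟨1, 0, 0, 19, 0⟩)
    {N : ℕ} [NeZero N] {K : Type} [Field K] [NumberField K] (hK : IsImaginaryQuadratic K)
    (hD3 : NumberField.discr K ≠ -3) (hD4 : NumberField.discr K ≠ -4)
    (hH : SatisfiesHeegnerHypothesis N K) {P : (W.baseChange K).toAffine.Point}
    (hP : IsHeegnerPoint N W K P) (hnt : ¬ IsOfFinAddOrder P) (hqN : 3 ∣ N)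
    (hI : padicValNat 5 (AddSubgroup.zmultiples P).index ≤
      padicValNat 5 ((W.baseChange ℚ_[3]).localTamagawaNumber ℤ_[3]))
    (hr : W.analyticRank ≤ 1) {s : ℚ} (hs : shaAn W = (s : ℂ)) (hv : padicValRat 5 s = 0) :
    BSDp W 5 :=
  bsdp_of_jetRowCarrierNe_of_serreWitnesses 5 (by norm_num) (by norm_num) 1 0 0 19 0
    (by decide +kernel) [(3, 1, 5), (5, 1, 1), (19, 1, 2)]
    (by intro t ht; simp only [List.mem_cons, List.not_mem_nil, or_false] at ht
        rcases ht with rfl | rfl | rfl <;> norm_num)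
    (by decide +kernel)
    (by decide +kernel) 7 11 17 (by norm_num) (by norm_num) (by norm_num) (by norm_num) (by norm_num)
    (by norm_num) (by norm_num) (by norm_num) (by norm_num) (by decide +kernel) (by decide +kernel)
    (by decide +kernel) (n₁ := 10) (n₂ := 18) (n₃ := 24) (by decide +kernel) (by decide +kernel)
    (by decide +kernel) (by decide +kernel) (by decide +kernel) (by decide +kernel) hJ hMcU hGZK hKo
    hrec hD36 hlev W hW hK hD3 hD4 hH hP hnt 3 Nat.prime_three hqN (by norm_num) hI hr hs hv

end Summit.BirchSwinnertonDyer.Rank1Residual.JET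

end
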